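import Mathlib.Analysis.InnerProductSpace.Basic
import HarnessLib

/-!
# Route `UnitScaleTilt`, crux K1 «MinimiserStabilityRegPr» (stmt-QuantumFields-19200), EX row `hGF` (curved member) — **(L6) Step I.1, ABSTRACT DOOR: SUM-OF-SQUARES LOCALISATION**
# (the first-order companion of the kernel editions ✓`Prop7IMSDoubleCommutatorDecay` ∕ `…Range` ∕ `…PerturbedBlock`; LOCATE-L6-ASSEMBLY-p1g24 §1 Org-I)

Cell `ym3-torus` (HUMAN RULING D-0037, rung R3 — NOT d = 4, NOT a mass gap, NOT Clay).  Width seat `ym-ust-19200-w5` (gen 13); chair ★`ym-ust-19200-p1` g24 («(L6) w5»).  THEOREMS ONLY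
(0 `def`, 0 `sorry`); `--supports stmt-QuantumFields-19200 --as helper`.  HONEST LABEL (№33 (6)): LOD-line supplier, CONDITIONAL on the member bricks; nothing of (3.49), `h349`, `hGF`, EX, the crux proved.

THE POINT.  The member's functional is `T_U(A) = re⟪A, Δ^η_U A⟫ + ‖P_U D*_U A‖² + a‖Q_k A‖²`: one finite-range KERNEL form (the Wilson Hessian — localised by the banded kernel edition) and two
SQUARES `‖T x‖²` of maps.  For a square no double commutator is needed: with cut-offs `M_j` on the source and `N_j` on the target, `T(M_j x) = N_j(T x) + K_j x` (`K_j` = the FIRST-order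
commutator) and Peter–Paul give `Σ_j ‖T(M_j x)‖² ≤ (1+θ)‖T x‖² + (1+θ⁻¹)Σ_j ‖K_j x‖²` as soon as `Σ_j ‖N_j y‖² ≤ ‖y‖²`.  Feeding a kernel-IMS row for `q₁`, commutator budgets for the squares
(absolute `κ²‖x‖²` plus, if wanted, a RELATIVE part `μ·q x` — the currency in which `[P,χ′]D*` is paid through ✓`Prop7RTermFloor.normSq_adjoint_le_normSq_projR_add`), the quadratic partition
`Σ_j ‖M_j x‖² = ‖x‖²` and LOCAL FLOORS `σ‖M_j x‖² ≤ q(M_j x)` yields the global floor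
`(σ − θν − ρ − (1+θ⁻¹)(κ₂² + κ₃²))·‖x‖² ≤ (1 + θ + (1+θ⁻¹)(μ₂ + μ₃))·q x`.
Maps are BARE FUNCTIONS between seminormed groups (no linearity is used), so the member instantiates with its `SiteL2K`∕`BondL2K` operators by `exact`.

WHAT IS PROVED (ns `…Theorems.Prop7IMSSumOfSquaresLocalisation`).
* §1 `normSq_add_le_weighted` (`‖u + w‖² ≤ (1+θ)‖u‖² + (1+θ⁻¹)‖w‖²`, `0 < θ`).
* §2 ★★ `sum_normSq_localise_le_of_comm` (commutators given as `T(M_j x) = N_j(T x) + K_j x`) and ★★ `sum_normSq_localise_le` (commutator written `T(M_j x) − N_j(T x)`).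
* §3 ★★★ `floor_of_localisation` (the door, `q = q₁ + ‖T₂·‖² + ‖T₃·‖²`) and `floor_of_localisation_slice` (the same read on `T₂ x = 0` — the slice form of the displayed `hGF` row).
* §4 (v2 APPEND) ★★★ `floor_of_localisation_rel` ∕ `floor_of_localisation_rel_slice` (Hessian row in the RELATIVE shape `Σ_j q₁(M_jx) ≤ (1+θ)q₁x + ρ‖x‖²`, no `ν`), `hessianRow_rel_of_exact`.
WHY IT MIGHT FAIL: nothing here (real arithmetic); at the member the budgets `κ², μ, ρ` must be `O(R′⁻²)`∕small against the local floor `σ` — the (L5x)∕(L6-χ) pens' rows.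

References: B. Simon, Ann. Inst. H. Poincaré A **38** (1983) 295–308 (IMS localisation); T. Bałaban, CMP **99** (1985) 389–434 [Balaban1985BackgroundPropagators] ((3.49) p.399, Thm 3.11 p.416).
-/

set_option autoImplicit false

noncomputable section

open scoped BigOperators
open Finset

namespace Summit.QuantumFields.YangMills.Theorems.Prop7IMSSumOfSquaresLocalisation

variable {E F : Type*} [SeminormedAddCommGroup E] [SeminormedAddCommGroup F] {J : Type*} [Fintype J]

/-! ## §1 Peter–Paul for norm squares -/

omit [Fintype J] in
/-- Weighted parallelogram bound: `‖u + w‖² ≤ (1+θ)‖u‖² + (1+θ⁻¹)‖w‖²` for `0 < θ`. [folklore] -/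
theorem normSq_add_le_weighted (u w : F) {θ : ℝ} (hθ : 0 < θ) :
    ‖u + w‖ ^ 2 ≤ (1 + θ) * ‖u‖ ^ 2 + (1 + θ⁻¹) * ‖w‖ ^ 2 := by
  have h1 : ‖u + w‖ ^ 2 ≤ (‖u‖ + ‖w‖) ^ 2 := pow_le_pow_left₀ (norm_nonneg _) (norm_add_le u w) 2
  have hw : θ * (θ⁻¹ * ‖w‖ ^ 2) = ‖w‖ ^ 2 := by rw [← mul_assoc, mul_inv_cancel₀ hθ.ne', one_mul]
  have h2 : θ * (2 * ‖u‖ * ‖w‖) ≤ θ * (θ * ‖u‖ ^ 2 + θ⁻¹ * ‖w‖ ^ 2) := by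
    rw [mul_add, hw]; nlinarith [sq_nonneg (θ * ‖u‖ - ‖w‖)]
  have h3 := le_of_mul_le_mul_left h2 hθ
  calc ‖u + w‖ ^ 2 ≤ (‖u‖ + ‖w‖) ^ 2 := h1
    _ = ‖u‖ ^ 2 + 2 * ‖u‖ * ‖w‖ + ‖w‖ ^ 2 := by ring
    _ ≤ (1 + θ) * ‖u‖ ^ 2 + (1 + θ⁻¹) * ‖w‖ ^ 2 := by linarith [h3]

/-! ## §2 Localising a square with first-order commutators -/

omit [SeminormedAddCommGroup E] in
/-- ★★ **LOCALISING A SQUARE, COMMUTATOR FORM.**  `T(M_j x) = N_j(T x) + K_j x` for every `j`, and the target cut-offs are a sub-partition (`Σ_j ‖N_j y‖² ≤ ‖y‖²`); then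
`Σ_j ‖T(M_j x)‖² ≤ (1+θ)·‖T x‖² + (1+θ⁻¹)·Σ_j ‖K_j x‖²` (`0 < θ`).  No linearity of `T, M_j, N_j, K_j` is used. [cite: Balaban1985BackgroundPropagators, Thm 3.11 p.416] -/
theorem sum_normSq_localise_le_of_comm (T : E → F) (M : J → E → E) (N : J → F → F) (K : J → E → F)
    (hcomm : ∀ j x, T (M j x) = N j (T x) + K j x)
    (hN : ∀ y : F, ∑ j, ‖N j y‖ ^ 2 ≤ ‖y‖ ^ 2) {θ : ℝ} (hθ : 0 < θ) (x : E) :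
    ∑ j, ‖T (M j x)‖ ^ 2 ≤ (1 + θ) * ‖T x‖ ^ 2 + (1 + θ⁻¹) * ∑ j, ‖K j x‖ ^ 2 := by
  have h : ∀ j, ‖T (M j x)‖ ^ 2 ≤ (1 + θ) * ‖N j (T x)‖ ^ 2 + (1 + θ⁻¹) * ‖K j x‖ ^ 2 := fun j => by
    rw [hcomm j x]; exact normSq_add_le_weighted _ _ hθ
  have hθ1 : 0 ≤ 1 + θ := by linarith
  calc ∑ j, ‖T (M j x)‖ ^ 2 ≤ ∑ j, ((1 + θ) * ‖N j (T x)‖ ^ 2 + (1 + θ⁻¹) * ‖K j x‖ ^ 2) := Finset.sum_le_sum fun j _ => h j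
    _ = (1 + θ) * ∑ j, ‖N j (T x)‖ ^ 2 + (1 + θ⁻¹) * ∑ j, ‖K j x‖ ^ 2 := by
        rw [Finset.sum_add_distrib, Finset.mul_sum, Finset.mul_sum]
    _ ≤ (1 + θ) * ‖T x‖ ^ 2 + (1 + θ⁻¹) * ∑ j, ‖K j x‖ ^ 2 := by
        have := mul_le_mul_of_nonneg_left (hN (T x)) hθ1
        linarith

omit [SeminormedAddCommGroup E] in
/-- ★★ **LOCALISING A SQUARE.**  Source cut-offs `M_j : E → E`, target cut-offs `N_j` with `Σ_j ‖N_j y‖² ≤ ‖y‖²`; then for every `0 < θ`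
`Σ_j ‖T(M_j x)‖² ≤ (1+θ)·‖T x‖² + (1+θ⁻¹)·Σ_j ‖T(M_j x) − N_j(T x)‖²` — only the FIRST-order commutators `T M_j − N_j T` enter. [cite: Balaban1985BackgroundPropagators, Thm 3.11 p.416] -/
theorem sum_normSq_localise_le (T : E → F) (M : J → E → E) (N : J → F → F)
    (hN : ∀ y : F, ∑ j, ‖N j y‖ ^ 2 ≤ ‖y‖ ^ 2) {θ : ℝ} (hθ : 0 < θ) (x : E) :
    ∑ j, ‖T (M j x)‖ ^ 2 ≤ (1 + θ) * ‖T x‖ ^ 2 + (1 + θ⁻¹) * ∑ j, ‖T (M j x) - N j (T x)‖ ^ 2 :=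
  sum_normSq_localise_le_of_comm T M N (fun j x => T (M j x) - N j (T x)) (fun j x => by abel) hN hθ x

/-! ## §3 The door -/

/-- ★★★ **THE SUM-OF-SQUARES LOCALISATION DOOR** ((L6) Step I.1 in abstract form).  Functional `q x = q₁ x + ‖T₂ x‖² + ‖T₃ x‖²`; source cut-offs `M_j` with the quadratic partition row
`Σ_j ‖M_j x‖² = ‖x‖²`; target sub-partitions `N₂, N₃`; a kernel-IMS row for `q₁` (`Σ_j q₁(M_j x) ≤ q₁ x + ρ‖x‖²`, e.g. half the error of ✓`Prop7IMSDoubleCommutatorRange`) and a floor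
`−ν‖x‖² ≤ q₁ x`; first-order commutator budgets `Σ_j ‖T_s(M_j x) − N_{s,j}(T_s x)‖² ≤ κ_s²‖x‖² + μ_s·q x` (`μ_s ≥ 0`: the relative currency); LOCAL FLOORS `σ‖M_j x‖² ≤ q(M_j x)`.
Then `(σ − θν − ρ − (1+θ⁻¹)(κ₂² + κ₃²))·‖x‖² ≤ (1 + θ + (1+θ⁻¹)(μ₂ + μ₃))·q x` for every `0 < θ`. [cite: Balaban1985BackgroundPropagators, (3.49) p.399, Thm 3.11 p.416] -/
theorem floor_of_localisation {F₂ F₃ : Type*} [SeminormedAddCommGroup F₂] [SeminormedAddCommGroup F₃]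
    (q₁ : E → ℝ) (T₂ : E → F₂) (T₃ : E → F₃) (M : J → E → E) (N₂ : J → F₂ → F₂) (N₃ : J → F₃ → F₃)
    {θ σ ρ ν κ₂ κ₃ μ₂ μ₃ : ℝ} (hθ : 0 < θ)
    (hM : ∀ x, ∑ j, ‖M j x‖ ^ 2 = ‖x‖ ^ 2)
    (hN₂ : ∀ y, ∑ j, ‖N₂ j y‖ ^ 2 ≤ ‖y‖ ^ 2) (hN₃ : ∀ y, ∑ j, ‖N₃ j y‖ ^ 2 ≤ ‖y‖ ^ 2)
    (hq₁ : ∀ x, ∑ j, q₁ (M j x) ≤ q₁ x + ρ * ‖x‖ ^ 2) (hν : ∀ x, -(ν * ‖x‖ ^ 2) ≤ q₁ x)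
    (hK₂ : ∀ x, ∑ j, ‖T₂ (M j x) - N₂ j (T₂ x)‖ ^ 2 ≤ κ₂ ^ 2 * ‖x‖ ^ 2 + μ₂ * (q₁ x + ‖T₂ x‖ ^ 2 + ‖T₃ x‖ ^ 2))
    (hK₃ : ∀ x, ∑ j, ‖T₃ (M j x) - N₃ j (T₃ x)‖ ^ 2 ≤ κ₃ ^ 2 * ‖x‖ ^ 2 + μ₃ * (q₁ x + ‖T₂ x‖ ^ 2 + ‖T₃ x‖ ^ 2))
    (hloc : ∀ j x, σ * ‖M j x‖ ^ 2 ≤ q₁ (M j x) + ‖T₂ (M j x)‖ ^ 2 + ‖T₃ (M j x)‖ ^ 2)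
    (x : E) :
    (σ - θ * ν - ρ - (1 + θ⁻¹) * (κ₂ ^ 2 + κ₃ ^ 2)) * ‖x‖ ^ 2
      ≤ (1 + θ + (1 + θ⁻¹) * (μ₂ + μ₃)) * (q₁ x + ‖T₂ x‖ ^ 2 + ‖T₃ x‖ ^ 2) := by
  have h2 := sum_normSq_localise_le T₂ M N₂ hN₂ hθ x
  have h3 := sum_normSq_localise_le T₃ M N₃ hN₃ hθ x
  have hloc' : σ * ‖x‖ ^ 2 ≤ ∑ j, q₁ (M j x) + ∑ j, ‖T₂ (M j x)‖ ^ 2 + ∑ j, ‖T₃ (M j x)‖ ^ 2 := by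
    rw [← hM x, Finset.mul_sum, ← Finset.sum_add_distrib, ← Finset.sum_add_distrib]
    exact Finset.sum_le_sum fun j _ => hloc j x
  have hθ' : 0 ≤ 1 + θ⁻¹ := by positivity
  have hK₂' := mul_le_mul_of_nonneg_left (hK₂ x) hθ'
  have hK₃' := mul_le_mul_of_nonneg_left (hK₃ x) hθ'
  have hν' := mul_le_mul_of_nonneg_left (hν x) hθ.le
  have hq := hq₁ x
  linarith [h2, h3, hloc', hq, hK₂', hK₃', hν']

/-- **THE DOOR READ ON THE SLICE** (`T₂ x = 0`, e.g. `R_S D* A = 0` behind the Lift clause — the shape of the displayed row `γ‖A‖² ≤ re⟪A, Δ^η A⟫ + a‖Q_k A‖²`):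
`(σ − θν − ρ − (1+θ⁻¹)(κ₂² + κ₃²))·‖x‖² ≤ (1 + θ + (1+θ⁻¹)(μ₂ + μ₃))·(q₁ x + ‖T₃ x‖²)`. [cite: Balaban1985BackgroundPropagators, (3.49) p.399] -/
theorem floor_of_localisation_slice {F₂ F₃ : Type*} [NormedAddCommGroup F₂] [SeminormedAddCommGroup F₃]
    (q₁ : E → ℝ) (T₂ : E → F₂) (T₃ : E → F₃) (M : J → E → E) (N₂ : J → F₂ → F₂) (N₃ : J → F₃ → F₃)
    {θ σ ρ ν κ₂ κ₃ μ₂ μ₃ : ℝ} (hθ : 0 < θ)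
    (hM : ∀ x, ∑ j, ‖M j x‖ ^ 2 = ‖x‖ ^ 2)
    (hN₂ : ∀ y, ∑ j, ‖N₂ j y‖ ^ 2 ≤ ‖y‖ ^ 2) (hN₃ : ∀ y, ∑ j, ‖N₃ j y‖ ^ 2 ≤ ‖y‖ ^ 2)
    (hq₁ : ∀ x, ∑ j, q₁ (M j x) ≤ q₁ x + ρ * ‖x‖ ^ 2) (hν : ∀ x, -(ν * ‖x‖ ^ 2) ≤ q₁ x)
    (hK₂ : ∀ x, ∑ j, ‖T₂ (M j x) - N₂ j (T₂ x)‖ ^ 2 ≤ κ₂ ^ 2 * ‖x‖ ^ 2 + μ₂ * (q₁ x + ‖T₂ x‖ ^ 2 + ‖T₃ x‖ ^ 2))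
    (hK₃ : ∀ x, ∑ j, ‖T₃ (M j x) - N₃ j (T₃ x)‖ ^ 2 ≤ κ₃ ^ 2 * ‖x‖ ^ 2 + μ₃ * (q₁ x + ‖T₂ x‖ ^ 2 + ‖T₃ x‖ ^ 2))
    (hloc : ∀ j x, σ * ‖M j x‖ ^ 2 ≤ q₁ (M j x) + ‖T₂ (M j x)‖ ^ 2 + ‖T₃ (M j x)‖ ^ 2)
    (x : E) (hx : T₂ x = 0) :
    (σ - θ * ν - ρ - (1 + θ⁻¹) * (κ₂ ^ 2 + κ₃ ^ 2)) * ‖x‖ ^ 2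
      ≤ (1 + θ + (1 + θ⁻¹) * (μ₂ + μ₃)) * (q₁ x + ‖T₃ x‖ ^ 2) := by
  have h := floor_of_localisation q₁ T₂ T₃ M N₂ N₃ hθ hM hN₂ hN₃ hq₁ hν hK₂ hK₃ hloc x
  rw [hx, norm_zero] at h
  simpa only [ne_eq, OfNat.ofNat_ne_zero, not_false_eq_true, zero_pow, add_zero] using h

/-! ## §4 (v2 APPEND, ★p1 g24 00:21:36Z currency pin) The door with the Hessian row in RELATIVE shape -/

/-- ★★★ **THE DOOR, RELATIVE HESSIAN EDITION.**  Same as `floor_of_localisation` but with the `q₁`-row in the shape the squares road delivers for a sum-of-squares-plus-remainder term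
(`re⟪X,Δ^ηX⟫ = c₀η⁻²·CURL + c₀η⁻²·P`, ✓`Prop7LocalCurlLetters`-class): `Σ_j q₁(M_j x) ≤ (1+θ)·q₁ x + ρ‖x‖²` with the SAME `θ` as the squares — then no floor on `q₁` is needed:
`Σ_j q(M_j x) ≤ (1 + θ + (1+θ⁻¹)(μ₂+μ₃))·q x + (ρ + (1+θ⁻¹)(κ₂²+κ₃²))‖x‖²`, hence with local floors `σ‖M_j x‖² ≤ q(M_j x)`:
`(σ − ρ − (1+θ⁻¹)(κ₂² + κ₃²))·‖x‖² ≤ (1 + θ + (1+θ⁻¹)(μ₂ + μ₃))·q x`.  (An exact kernel-IMS row with coefficient `1` and a floor `−ν‖x‖² ≤ q₁ x` docks here via `ρ ↦ ρ + θν`.)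
[cite: Balaban1985BackgroundPropagators, (3.49) p.399, Thm 3.11 p.416] -/
theorem floor_of_localisation_rel {F₂ F₃ : Type*} [SeminormedAddCommGroup F₂] [SeminormedAddCommGroup F₃]
    (q₁ : E → ℝ) (T₂ : E → F₂) (T₃ : E → F₃) (M : J → E → E) (N₂ : J → F₂ → F₂) (N₃ : J → F₃ → F₃)
    {θ σ ρ κ₂ κ₃ μ₂ μ₃ : ℝ} (hθ : 0 < θ)
    (hM : ∀ x, ∑ j, ‖M j x‖ ^ 2 = ‖x‖ ^ 2)
    (hN₂ : ∀ y, ∑ j, ‖N₂ j y‖ ^ 2 ≤ ‖y‖ ^ 2) (hN₃ : ∀ y, ∑ j, ‖N₃ j y‖ ^ 2 ≤ ‖y‖ ^ 2)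
    (hq₁ : ∀ x, ∑ j, q₁ (M j x) ≤ (1 + θ) * q₁ x + ρ * ‖x‖ ^ 2)
    (hK₂ : ∀ x, ∑ j, ‖T₂ (M j x) - N₂ j (T₂ x)‖ ^ 2 ≤ κ₂ ^ 2 * ‖x‖ ^ 2 + μ₂ * (q₁ x + ‖T₂ x‖ ^ 2 + ‖T₃ x‖ ^ 2))
    (hK₃ : ∀ x, ∑ j, ‖T₃ (M j x) - N₃ j (T₃ x)‖ ^ 2 ≤ κ₃ ^ 2 * ‖x‖ ^ 2 + μ₃ * (q₁ x + ‖T₂ x‖ ^ 2 + ‖T₃ x‖ ^ 2))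
    (hloc : ∀ j x, σ * ‖M j x‖ ^ 2 ≤ q₁ (M j x) + ‖T₂ (M j x)‖ ^ 2 + ‖T₃ (M j x)‖ ^ 2)
    (x : E) :
    (σ - ρ - (1 + θ⁻¹) * (κ₂ ^ 2 + κ₃ ^ 2)) * ‖x‖ ^ 2
      ≤ (1 + θ + (1 + θ⁻¹) * (μ₂ + μ₃)) * (q₁ x + ‖T₂ x‖ ^ 2 + ‖T₃ x‖ ^ 2) := by
  have h2 := sum_normSq_localise_le T₂ M N₂ hN₂ hθ x
  have h3 := sum_normSq_localise_le T₃ M N₃ hN₃ hθ x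
  have hloc' : σ * ‖x‖ ^ 2 ≤ ∑ j, q₁ (M j x) + ∑ j, ‖T₂ (M j x)‖ ^ 2 + ∑ j, ‖T₃ (M j x)‖ ^ 2 := by
    rw [← hM x, Finset.mul_sum, ← Finset.sum_add_distrib, ← Finset.sum_add_distrib]
    exact Finset.sum_le_sum fun j _ => hloc j x
  have hθ' : 0 ≤ 1 + θ⁻¹ := by positivity
  have hK₂' := mul_le_mul_of_nonneg_left (hK₂ x) hθ'
  have hK₃' := mul_le_mul_of_nonneg_left (hK₃ x) hθ'
  have hq := hq₁ x
  linarith [h2, h3, hloc', hq, hK₂', hK₃']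

/-- **THE RELATIVE DOOR READ ON THE SLICE** (`T₂ x = 0`): `(σ − ρ − (1+θ⁻¹)(κ₂² + κ₃²))·‖x‖² ≤ (1 + θ + (1+θ⁻¹)(μ₂ + μ₃))·(q₁ x + ‖T₃ x‖²)`.
[cite: Balaban1985BackgroundPropagators, (3.49) p.399] -/
theorem floor_of_localisation_rel_slice {F₂ F₃ : Type*} [NormedAddCommGroup F₂] [SeminormedAddCommGroup F₃]
    (q₁ : E → ℝ) (T₂ : E → F₂) (T₃ : E → F₃) (M : J → E → E) (N₂ : J → F₂ → F₂) (N₃ : J → F₃ → F₃)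
    {θ σ ρ κ₂ κ₃ μ₂ μ₃ : ℝ} (hθ : 0 < θ)
    (hM : ∀ x, ∑ j, ‖M j x‖ ^ 2 = ‖x‖ ^ 2)
    (hN₂ : ∀ y, ∑ j, ‖N₂ j y‖ ^ 2 ≤ ‖y‖ ^ 2) (hN₃ : ∀ y, ∑ j, ‖N₃ j y‖ ^ 2 ≤ ‖y‖ ^ 2)
    (hq₁ : ∀ x, ∑ j, q₁ (M j x) ≤ (1 + θ) * q₁ x + ρ * ‖x‖ ^ 2)
    (hK₂ : ∀ x, ∑ j, ‖T₂ (M j x) - N₂ j (T₂ x)‖ ^ 2 ≤ κ₂ ^ 2 * ‖x‖ ^ 2 + μ₂ * (q₁ x + ‖T₂ x‖ ^ 2 + ‖T₃ x‖ ^ 2))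
    (hK₃ : ∀ x, ∑ j, ‖T₃ (M j x) - N₃ j (T₃ x)‖ ^ 2 ≤ κ₃ ^ 2 * ‖x‖ ^ 2 + μ₃ * (q₁ x + ‖T₂ x‖ ^ 2 + ‖T₃ x‖ ^ 2))
    (hloc : ∀ j x, σ * ‖M j x‖ ^ 2 ≤ q₁ (M j x) + ‖T₂ (M j x)‖ ^ 2 + ‖T₃ (M j x)‖ ^ 2)
    (x : E) (hx : T₂ x = 0) :
    (σ - ρ - (1 + θ⁻¹) * (κ₂ ^ 2 + κ₃ ^ 2)) * ‖x‖ ^ 2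
      ≤ (1 + θ + (1 + θ⁻¹) * (μ₂ + μ₃)) * (q₁ x + ‖T₃ x‖ ^ 2) := by
  have h := floor_of_localisation_rel q₁ T₂ T₃ M N₂ N₃ hθ hM hN₂ hN₃ hq₁ hK₂ hK₃ hloc x
  rw [hx, norm_zero] at h
  simpa only [ne_eq, OfNat.ofNat_ne_zero, not_false_eq_true, zero_pow, add_zero] using h

/-- **DOCKING AN EXACT KERNEL-IMS ROW**: `Σ_j q₁(M_j x) ≤ q₁ x + ρ‖x‖²` and `−ν‖x‖² ≤ q₁ x` give the relative shape `Σ_j q₁(M_j x) ≤ (1+θ)·q₁ x + (ρ + θν)‖x‖²` for every `0 ≤ θ`. [folklore] -/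
theorem hessianRow_rel_of_exact (q₁ : E → ℝ) (M : J → E → E) {θ ρ ν : ℝ} (hθ : 0 ≤ θ)
    (hq₁ : ∀ x, ∑ j, q₁ (M j x) ≤ q₁ x + ρ * ‖x‖ ^ 2) (hν : ∀ x, -(ν * ‖x‖ ^ 2) ≤ q₁ x) (x : E) :
    ∑ j, q₁ (M j x) ≤ (1 + θ) * q₁ x + (ρ + θ * ν) * ‖x‖ ^ 2 := by
  have h1 := hq₁ x
  have h2 := mul_le_mul_of_nonneg_left (hν x) hθ
  linarith

end Summit.QuantumFields.YangMills.Theorems.Prop7IMSSumOfSquaresLocalisation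

end
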